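import Summits.AnomalousDissipation.AnomalousDissipation.Theorems.SawtoothPulseCascadeK1LocalisedCascadeKHSheetBlock
import Mathlib.Analysis.ODE.Gronwall
import Mathlib.Analysis.ODE.ExistUnique
import Mathlib.Topology.Algebra.Module.FiniteDimension

/-!
# K2 lane (route-2 `SawtoothPulseCascade`, crux dir `K1LocalisedCascade`): the EXPLICIT PROPAGATOR of the Kelvin–Helmholtz sheet block

Helper file of the K2 lane (S2 `KHSheetLyapunov` / `KHSheetAbsolute` of planner p4 g14's `Cruxes/K1LocalisedCascade/K2ControlSketch.lean`;
ACL item stmt-AnomalousDissipation-19491). The sheet block `F v = ik(−p v₀ − 2S v₁, 2S̄ v₀ + p v₁)` (p4's `khField k β`, written out and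
named by a hypothesis `hF`) is ℂ-linear with `F ∘ F = λ·Id`, `λ = −k² c²(k,β)` (`khBlock_sq`). Hence for ANY pair of real functions with
`C′ = λ·Sn`, `Sn′ = C`, `C 0 = 1`, `Sn 0 = 0` (i.e. `cosh √λ θ, sinh √λ θ/√λ` for `λ > 0`; `cos, sin/ω` for `λ = −ω² < 0`; `1, θ` for `λ = 0`)
the curve `θ ↦ C θ • v + Sn θ • F v` solves `q′ = F q` (`sheetPropagator_hasDerivAt`), and by Lipschitz uniqueness EVERY solution on
`[0, γ]` in the sense of the S2 stubs (`HasDerivWithinAt q (F (q θ)) (Icc 0 γ) θ`) is of this form (`sheet_solution_eq`). So the S2 constants are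
suprema of explicit scalar expressions in `(k, β, θ)` — an ODE-free table. No definitions; no statement about the crux.
[cite: Drazin2002, §8.3 (8.36)–(8.38) (Rayleigh jump conditions at the kinks of a broken-line profile)] [problem: turb]
-/

-- `Summit.<Summit>.<Problem>`: single-conjunct summit, the duplicate namespace segment is deliberate.
set_option linter.dupNamespace false

noncomputable section

namespace Summit.AnomalousDissipation.AnomalousDissipation.Theorems.SawtoothPulseCascade.K2PhaseBudget

open Set Real Complex Literature.Analysis.FluidPDE.SawtoothCascade

/-! ## §1 Linearity and the square of the block as a map on `Fin 2 → ℂ` -/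

/-- The sheet block is additive-homogeneous: `F (a•v + b•w) = a•F v + b•F w`. [folklore] -/
theorem sheetBlock_linear {k : ℝ} {p S : ℂ} {F : (Fin 2 → ℂ) → (Fin 2 → ℂ)}
    (hF : F = fun v => ![I * k * (-p * v 0 - 2 * S * v 1), I * k * (2 * (starRingEnd ℂ) S * v 0 + p * v 1)])
    (a b : ℂ) (v w : Fin 2 → ℂ) : F (a • v + b • w) = a • F v + b • F w := by
  subst hF
  ext i
  fin_cases i <;> simp <;> ring

/-- The sheet block squares to the scalar `λ = −k²c²(k,β)`: `F (F v) = λ • v`. [cite: Drazin2002, §8.3 (8.36)–(8.38)] -/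
theorem sheetBlock_sq {k β : ℝ} {p S : ℂ} {F : (Fin 2 → ℂ) → (Fin 2 → ℂ)}
    (hp : p = ((π / 2 + 2 * sawSigma0 k β : ℝ) : ℂ)) (hS : S = sawS k β)
    (hF : F = fun v => ![I * k * (-p * v 0 - 2 * S * v 1), I * k * (2 * (starRingEnd ℂ) S * v 0 + p * v 1)])
    (v : Fin 2 → ℂ) : F (F v) = (-(((k ^ 2 * sawC2 k β : ℝ) : ℂ))) • v := by
  obtain ⟨h0, h1⟩ := khBlock_sq k β hp hS (v 0) (v 1)
  subst hF
  ext i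
  fin_cases i
  · simp only [Fin.zero_eta, Fin.isValue, Matrix.cons_val_zero, Matrix.cons_val_one,
      Matrix.cons_val_fin_one, Pi.smul_apply, smul_eq_mul]
    linear_combination h0
  · simp only [Fin.mk_one, Fin.isValue, Matrix.cons_val_zero, Matrix.cons_val_one,
      Matrix.cons_val_fin_one, Pi.smul_apply, smul_eq_mul]
    linear_combination h1

/-- The sheet block is Lipschitz (it is a continuous ℝ-linear map of a finite-dimensional space). [folklore] -/
theorem sheetBlock_lipschitz {k : ℝ} {p S : ℂ} {F : (Fin 2 → ℂ) → (Fin 2 → ℂ)}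
    (hF : F = fun v => ![I * k * (-p * v 0 - 2 * S * v 1), I * k * (2 * (starRingEnd ℂ) S * v 0 + p * v 1)]) :
    ∃ K, LipschitzWith K F := by
  let L : (Fin 2 → ℂ) →ₗ[ℂ] (Fin 2 → ℂ) :=
    { toFun := F
      map_add' := fun v w => by
        have := sheetBlock_linear hF 1 1 v w
        simpa using this
      map_smul' := fun a v => by
        have := sheetBlock_linear hF a 0 v v
        simpa using this }
  let Lc : (Fin 2 → ℂ) →L[ℂ] (Fin 2 → ℂ) := LinearMap.toContinuousLinearMap L
  refine ⟨‖Lc‖₊, ?_⟩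
  have h : (Lc : (Fin 2 → ℂ) → (Fin 2 → ℂ)) = F := rfl
  rw [← h]
  exact Lc.lipschitz

/-! ## §2 The explicit propagator solves the block ODE -/

/-- **Explicit propagator.** If `C′ = λ·Sn` and `Sn′ = C` (`λ = −k²c²(k,β)`), then `θ ↦ C θ • v + Sn θ • F v` solves `q′ = F q`.
[cite: Drazin2002, §8.3 (8.36)–(8.38)] -/
theorem sheetPropagator_hasDerivAt {k β : ℝ} {p S : ℂ} {F : (Fin 2 → ℂ) → (Fin 2 → ℂ)}
    (hp : p = ((π / 2 + 2 * sawSigma0 k β : ℝ) : ℂ)) (hS : S = sawS k β)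
    (hF : F = fun v => ![I * k * (-p * v 0 - 2 * S * v 1), I * k * (2 * (starRingEnd ℂ) S * v 0 + p * v 1)])
    {C Sn : ℝ → ℝ} (hC : ∀ θ, HasDerivAt C (-(k ^ 2 * sawC2 k β) * Sn θ) θ) (hSn : ∀ θ, HasDerivAt Sn (C θ) θ)
    (v : Fin 2 → ℂ) (θ : ℝ) :
    HasDerivAt (fun t : ℝ => ((C t : ℝ) : ℂ) • v + ((Sn t : ℝ) : ℂ) • F v)
      (F (((C θ : ℝ) : ℂ) • v + ((Sn θ : ℝ) : ℂ) • F v)) θ := by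
  have h1 : HasDerivAt (fun t : ℝ => ((C t : ℝ) : ℂ) • v) ((((-(k ^ 2 * sawC2 k β) * Sn θ : ℝ)) : ℂ) • v) θ :=
    (hC θ).ofReal_comp.smul_const v
  have h2 : HasDerivAt (fun t : ℝ => ((Sn t : ℝ) : ℂ) • F v) (((C θ : ℝ) : ℂ) • F v) θ :=
    (hSn θ).ofReal_comp.smul_const (F v)
  have h := h1.add h2
  refine (h.congr_deriv ?_)
  rw [sheetBlock_linear hF, sheetBlock_sq hp hS hF, smul_smul, add_comm]
  have e : (((-(k ^ 2 * sawC2 k β) * Sn θ : ℝ)) : ℂ) = ((Sn θ : ℝ) : ℂ) * (-(((k ^ 2 * sawC2 k β : ℝ) : ℂ))) := by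
    push_cast; ring
  rw [e]

/-! ## §3 Every solution on `[0, γ]` is the propagator applied to its datum -/

/-- **Solution formula.** Every `q : ℝ → (Fin 2 → ℂ)` with `HasDerivWithinAt q (F (q θ)) (Icc 0 γ) θ` for all `θ ∈ [0, γ]` (the hypothesis
shape of the S2 stubs) satisfies `q θ = C θ • q 0 + Sn θ • F (q 0)` on `[0, γ]`, for any `C, Sn` with `C′ = λSn`, `Sn′ = C`, `C 0 = 1`,
`Sn 0 = 0` (Lipschitz uniqueness, `ODE_solution_unique`). [cite: Drazin2002, §8.3 (8.36)–(8.38)] -/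
theorem sheet_solution_eq {k β γ : ℝ} {p S : ℂ} {F : (Fin 2 → ℂ) → (Fin 2 → ℂ)}
    (hp : p = ((π / 2 + 2 * sawSigma0 k β : ℝ) : ℂ)) (hS : S = sawS k β)
    (hF : F = fun v => ![I * k * (-p * v 0 - 2 * S * v 1), I * k * (2 * (starRingEnd ℂ) S * v 0 + p * v 1)])
    {C Sn : ℝ → ℝ} (hC : ∀ θ, HasDerivAt C (-(k ^ 2 * sawC2 k β) * Sn θ) θ) (hSn : ∀ θ, HasDerivAt Sn (C θ) θ)
    (hC0 : C 0 = 1) (hSn0 : Sn 0 = 0)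
    {q : ℝ → (Fin 2 → ℂ)} (hq : ∀ θ ∈ Icc (0 : ℝ) γ, HasDerivWithinAt q (F (q θ)) (Icc (0 : ℝ) γ) θ) :
    ∀ θ ∈ Icc (0 : ℝ) γ, q θ = ((C θ : ℝ) : ℂ) • q 0 + ((Sn θ : ℝ) : ℂ) • F (q 0) := by
  obtain ⟨K, hK⟩ := sheetBlock_lipschitz hF
  set P : ℝ → (Fin 2 → ℂ) := fun t => ((C t : ℝ) : ℂ) • q 0 + ((Sn t : ℝ) : ℂ) • F (q 0) with hP_def
  have hPd : ∀ t, HasDerivAt P (F (P t)) t := fun t => sheetPropagator_hasDerivAt hp hS hF hC hSn (q 0) t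
  -- uniqueness on `Icc 0 γ`
  have hqc : ContinuousOn q (Icc 0 γ) := fun t ht => (hq t ht).continuousWithinAt
  have hPc : ContinuousOn P (Icc 0 γ) := fun t _ => (hPd t).continuousAt.continuousWithinAt
  have hq' : ∀ t ∈ Ico (0 : ℝ) γ, HasDerivWithinAt q (F (q t)) (Ici t) t := by
    intro t ht
    have h := hq t ⟨ht.1, ht.2.le⟩
    apply h.mono_of_mem_nhdsWithin
    exact Filter.mem_of_superset (Icc_mem_nhdsGE ht.2) (Icc_subset_Icc ht.1 le_rfl)
  have hP' : ∀ t ∈ Ico (0 : ℝ) γ, HasDerivWithinAt P (F (P t)) (Ici t) t :=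
    fun t _ => (hPd t).hasDerivWithinAt
  have h0 : q 0 = P 0 := by
    simp [hP_def, hC0, hSn0]
  have heq := ODE_solution_unique (v := fun _ => F) (fun _ => hK) hqc hq' hPc hP' h0
  intro θ hθ
  exact heq hθ

end Summit.AnomalousDissipation.AnomalousDissipation.Theorems.SawtoothPulseCascade.K2PhaseBudget

end
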